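import Literature.MathematicalPhysics.QuantumChemistry.FrozenCoreHamiltonian
import Summits.Ventures.CertifiedQuantumChemistry.Rows.SingletRows
import HarnessLib

/-!
# Ventures/CertifiedQuantumChemistry — Rows/FrozenCoreRows.lean: an active-space (frozen-core) model
# bounds the full-basis model FROM ABOVE ONLY — upper rows transport, lower rows do not

HONEST FRAMING (verbatim): certified bounds for a stated model Hamiltonian in a stated basis; not a
claim about the real molecule beyond that model.

Seat rdm-B (gen 20), ROWS courtesy file ROWS-40 (theorems only; no `def`, no notation, no row, no claim
node; nothing here asserts a bound about any deposited model). The MODEL-level end of the frozen-core set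
`Literature/MathematicalPhysics/QuantumLattice/FrozenEnvironment{Embedding,Words,Compression}.lean` +
`Literature/MathematicalPhysics/QuantumChemistry/FrozenCoreHamiltonian.lean`.

Every integral file of the cell above `k = 10` is an ACTIVE-SPACE model: `F : Model k` = (the rationals
printed by) an FCIDUMP of `k` active orbitals with a constant `ecore` absorbing the frozen core (Cr₂
(24e,30o), [2Fe-2S] (30e,20o), FeMoco (54e,54o), …). Relative to any larger model `F' : Model k'` of the
same molecule in the same one-particle basis (more orbitals unfrozen), `F` is the FROZEN-CORE REDUCTION of
`F'` along an order embedding `φ : Fin k ↪o Fin k'` of the active orbitals with a core set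
`C ⊆ Fin k'`, `φ x ∉ C`: hypotheses `hh` (`F.h` = the inactive Fock matrix of `F'` on the active
orbitals, general-table form), `hg` (`F.eri` = `F'.eri` on active indices), `hc`
(`F.ecore = F'.ecore + E_core`). Under exactly these hypotheses (no symmetry of the tables needed):

* `Model.hamiltonian_frozenCore`: `Vᴴ H_{F'} V = H_F` for the frozen-core isometry
  `V = frozenEmbed (orbEmb φ) (orbs C)` (the Literature theorem read at the rational tables);
* `spinPlus_mul_frozenEmbed_orbs`: a closed-shell core is a singlet, `Ŝ_+ V = V Ŝ_+`, so `V` maps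
  `singletSector k n` into `singletSector k' (n + |C|)` (`frozenEmbed_orbs_mulVec_mem_singletSector`);
* **`Model.energy_le_frozenCore`**: `F'.energy (a + |C|) (b + |C|) ≤ F.energy a b` (`a, b ≤ k`);
  **`Model.singletEnergy_le_frozenCore`**: `F'.singletEnergy (n + |C|) ≤ F.singletEnergy n` (`n ≤ k`);
* `Model.isSymmetric_frozenCore`: the reduction of a symmetric model is symmetric;
* **`UpperRow.frozenCore`**, **`SingletUpperRow.frozenCore`**: an UPPER row of the active-space model IS
  an upper row of the full model in the shifted sector (`k + |C| ≤ k'`, `card_active_add_core_le`,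
  supplies the range); the no-core case `C = ∅` is basis truncation: `Model.energy_le_restrict`,
  `UpperRow.restrict` (adding orbitals to a model can only lower its exact energies).

WHAT IS NOT HERE, BECAUSE IT IS FALSE IN GENERAL: the transport of LOWER rows. `F.energy a b` is the
minimum of `H_{F'}` over the frozen-core wave functions only; unfreezing the core can lower the energy,
so a certified `lo ≤ F.energy a b` is a statement about the STATED active-space model `F` and nothing
else — the cell's honest-framing sentence as a one-directional theorem. (Nor is anything said about
which `F'` a deposited file came from: that is reader / provenance data, `FORMAT-pin1.md`.)

References: T. Helgaker, P. Jørgensen, J. Olsen, *Molecular Electronic-Structure Theory* (2000) §12.5.1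
(12.5.12), (12.5.16); E. Koridon et al., Phys. Rev. Research 3 (2021) 033127, App. A; the cell's
`Statement.lean` (`Model`, `Model.energy`, `Model.singletEnergy`, row predicates).
-/

noncomputable section

namespace Summit.Ventures.CertifiedQuantumChemistry

open Matrix Finset
open Literature.MathematicalPhysics.QuantumLattice Literature.MathematicalPhysics.QuantumChemistry JWEmbed

/-! ## A closed-shell core is a singlet -/

section Operator

variable {Λ Λ' : Type*} [LinearOrder Λ] [Fintype Λ] [LinearOrder Λ'] [Fintype Λ'] (φ : Λ ↪o Λ')
  {C : Finset Λ'}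

/-- A sum over the sites of the big basis = the sum over the active sites + the sum over the others. -/
theorem sum_eq_sum_apply_add_sum_compl_range {M : Type*} [AddCommMonoid M] (f : Λ' → M) :
    ∑ p, f p = ∑ x, f (φ x) + ∑ p ∈ (Finset.univ.map φ.toEmbedding)ᶜ, f p := by
  rw [← Finset.sum_add_sum_compl (Finset.univ.map φ.toEmbedding) f, Finset.sum_map]
  rfl

/-- **A closed-shell core is a singlet**: `Ŝ_+ V = V Ŝ_+` for the frozen-core isometry (the core terms
`c†_{c↑} c_{c↓}` of `Ŝ_+` vanish on the doubly occupied core and on the empty virtual orbitals, the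
active terms are intertwined). -/
theorem spinPlus_mul_frozenEmbed_orbs (hC : ∀ x, φ x ∉ C) :
    (spinPlus : Matrix (Finset (Orb Λ')) (Finset (Orb Λ')) ℂ) * frozenEmbed (orbEmb φ) (orbs C) =
      frozenEmbed (orbEmb φ) (orbs C) * (spinPlus : Matrix (Finset (Orb Λ)) (Finset (Orb Λ)) ℂ) := by
  have hK := disjoint_orbs_rangeF_orbEmb φ hC
  rw [spinPlus, spinPlus, Matrix.sum_mul, Matrix.mul_sum, sum_eq_sum_apply_add_sum_compl_range φ]
  have h0 : ∑ p ∈ (Finset.univ.map φ.toEmbedding)ᶜ,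
      creation (orb p 0) * annihilation (orb p 1) * frozenEmbed (orbEmb φ) (orbs C) = 0 := by
    refine Finset.sum_eq_zero fun p hp => ?_
    have hp' : ∀ x, φ x ≠ p := fun x hx =>
      (Finset.mem_compl.1 hp) (Finset.mem_map.2 ⟨x, Finset.mem_univ _, hx⟩)
    by_cases hpC : p ∈ C
    · exact creation_mul_annihilation_mul_frozenEmbed_eq_zero _ (orb_mem_orbs.2 hpC)
        (fun h => absurd (orb_eq_orb_iff.1 h).2 (by decide))
    · rw [Matrix.mul_assoc, annihilation_mul_frozenEmbed_eq_zero _ (orb_not_mem_rangeF_orbEmb φ hp' 1)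
        (fun h => hpC (orb_mem_orbs.1 h)), Matrix.mul_zero]
  rw [h0, add_zero]
  refine Finset.sum_congr rfl fun x _ => ?_
  rw [← orbEmb_orb, ← orbEmb_orb, Matrix.mul_assoc, annihilation_apply_mul_frozenEmbed _ hK,
    ← Matrix.mul_assoc, creation_apply_mul_frozenEmbed _ hK, Matrix.mul_assoc]

/-- **Variational transport along an isometry into a sector**: if `V` is an isometry mapping the
nonzero subspace `K` into `K'`, then `minEnergyOn A K' ≤ minEnergyOn (Vᴴ A V) K` (every Rayleigh value of
the compression is a Rayleigh value of `A` on `K'`). -/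
theorem minEnergyOn_le_minEnergyOn_compression {κ n : Type*} [LinearOrder κ] [Fintype κ] [Fintype n]
    [DecidableEq n] (A : Matrix (Finset κ) (Finset κ) ℂ) (V : Matrix (Finset κ) n ℂ) (hV : Vᴴ * V = 1)
    (K : Submodule ℂ (n → ℂ)) (K' : Submodule ℂ (Fock κ)) (hK : K ≠ ⊥) (hmap : ∀ ψ ∈ K, V *ᵥ ψ ∈ K') :
    A.minEnergyOn K' ≤ (Vᴴ * A * V).minEnergyOn K := by
  unfold Matrix.minEnergyOn
  refine le_csInf ?_ ?_
  · obtain ⟨ψ, hψ, hψ0⟩ := (Submodule.ne_bot_iff _).1 hK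
    obtain ⟨c, -, hc1⟩ := exists_smul_unit hψ0
    exact ⟨_, c • ψ, K.smul_mem c hψ, hc1, rfl⟩
  · rintro E ⟨ψ, hψ, hψ1, rfl⟩
    refine csInf_le ⟨-(∑ s, ∑ t, ‖A s t‖), ?_⟩ ⟨V *ᵥ ψ, hmap ψ hψ, ?_, ?_⟩
    · rintro E' ⟨u, -, hu1, rfl⟩
      exact neg_sum_norm_le_re_expect A hu1
    · rw [star_mulVec, ← dotProduct_mulVec, mulVec_mulVec, hV, one_mulVec, hψ1]
    · rw [star_mulVec, ← dotProduct_mulVec, mulVec_mulVec, mulVec_mulVec]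

end Operator

/-! ## The model level -/

section Model

variable {k k' : ℕ} (φ : Fin k ↪o Fin k') {C : Finset (Fin k')}

/-- The active orbitals and the core fit into the full basis: `k + |C| ≤ k'`. -/
theorem card_active_add_core_le (hC : ∀ x, φ x ∉ C) : k + C.card ≤ k' := by
  have hdis : Disjoint ((Finset.univ : Finset (Fin k)).map φ.toEmbedding) C :=
    Finset.disjoint_left.2 fun p hp hpC => by
      obtain ⟨x, -, rfl⟩ := Finset.mem_map.1 hp
      exact hC x hpC
  have h := Finset.card_le_univ ((Finset.univ : Finset (Fin k)).map φ.toEmbedding ∪ C)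
  rwa [Finset.card_union_of_disjoint hdis, Finset.card_map, Finset.card_univ, Fintype.card_fin,
    Fintype.card_fin] at h

/-- **`Vᴴ H_{F'} V = H_F`**: the Hamiltonian of the active-space model `F` is the compression of the
Hamiltonian of the full model `F'` to the frozen-core wave functions, whenever the tables of `F` are the
frozen-core reduction of those of `F'` (`hh`: inactive Fock matrix on the active orbitals, general-table
form; `hg`: active two-electron integrals; `hc`: `ecore` shifted by the core energy). -/
theorem Model.hamiltonian_frozenCore {F : Model k} {F' : Model k'} (hC : ∀ x, φ x ∉ C)
    (hh : ∀ x y, F.h x y = F'.h (φ x) (φ y) + ∑ c ∈ C, (F'.eri (φ x) (φ y) c c + F'.eri c c (φ x) (φ y)) -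
      (1 / 2 : ℚ) * ∑ c ∈ C, (F'.eri (φ x) c c (φ y) + F'.eri c (φ y) (φ x) c))
    (hg : ∀ x y z w, F.eri x y z w = F'.eri (φ x) (φ y) (φ z) (φ w))
    (hc : F.ecore = F'.ecore + (2 * ∑ c ∈ C, F'.h c c + ∑ c ∈ C, ∑ d ∈ C, (2 * F'.eri c c d d - F'.eri c d d c))) :
    (frozenEmbed (orbEmb φ) (orbs C))ᴴ * F'.hamiltonian * frozenEmbed (orbEmb φ) (orbs C) = F.hamiltonian := by
  rw [Model.hamiltonian, Model.hamiltonian,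
    conjTranspose_frozenEmbed_mul_molecularHamiltonian_mul_frozenEmbed φ hC]
  congr 1
  · funext x y
    rw [hh]
    push_cast
    rfl
  · funext x y z w
    rw [hg]
  · rw [hc]
    push_cast
    rfl

/-- The frozen-core reduction of a SYMMETRIC model is symmetric (`h` symmetric, `(pq|rs) = (qp|sr)`), so the
lower-certificate soundness theorems apply to the active-space model as they do to the full one. -/
theorem Model.isSymmetric_frozenCore {F : Model k} {F' : Model k'}
    (hh : ∀ x y, F.h x y = F'.h (φ x) (φ y) + ∑ c ∈ C, (F'.eri (φ x) (φ y) c c + F'.eri c c (φ x) (φ y)) -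
      (1 / 2 : ℚ) * ∑ c ∈ C, (F'.eri (φ x) c c (φ y) + F'.eri c (φ y) (φ x) c))
    (hg : ∀ x y z w, F.eri x y z w = F'.eri (φ x) (φ y) (φ z) (φ w)) (hF' : F'.IsSymmetric) :
    F.IsSymmetric := by
  refine ⟨fun x y => ?_, fun x y z w => ?_⟩
  · rw [hh, hh, hF'.1 (φ x) (φ y)]
    have h1 : ∀ c, F'.eri (φ y) (φ x) c c = F'.eri (φ x) (φ y) c c := fun c => (hF'.2 _ _ _ _).symm
    have h2 : ∀ c, F'.eri c c (φ y) (φ x) = F'.eri c c (φ x) (φ y) := fun c => (hF'.2 _ _ _ _).symm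
    have h3 : ∀ c, F'.eri (φ y) c c (φ x) = F'.eri c (φ y) (φ x) c := fun c => hF'.2 _ _ _ _
    have h4 : ∀ c, F'.eri c (φ x) (φ y) c = F'.eri (φ x) c c (φ y) := fun c => hF'.2 _ _ _ _
    simp only [h1, h2, h3, h4]
    congr 2
    exact Finset.sum_congr rfl fun c _ => add_comm _ _
  · rw [hg, hg, hF'.2]

/-- `V` maps the singlet subspace of the `2n`-electron sector of the active model into the singlet subspace
of the `2(n + |C|)`-electron sector of the full model. -/
theorem frozenEmbed_orbs_mulVec_mem_singletSector (hC : ∀ x, φ x ∉ C) {n : ℕ} {ψ : Fock (Orb (Fin k))}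
    (hψ : ψ ∈ singletSector k n) :
    frozenEmbed (orbEmb φ) (orbs C) *ᵥ ψ ∈ singletSector k' (n + C.card) := by
  rw [mem_singletSector_iff] at hψ ⊢
  refine ⟨(mem_szSector_iff_isInSector _ _ _).2
    (isInSector_frozenEmbed_orbs_mulVec φ hC ((mem_szSector_iff_isInSector n n ψ).1 hψ.1)), ?_⟩
  rw [mulVec_mulVec, spinPlus_mul_frozenEmbed_orbs φ hC, ← mulVec_mulVec, hψ.2, mulVec_zero]

/-- **THE SECTOR ENERGIES OF THE FULL MODEL ARE BOUNDED ABOVE BY THOSE OF ITS FROZEN-CORE REDUCTION**: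
`F'.energy (a + |C|) (b + |C|) ≤ F.energy a b` for every physical active sector `a, b ≤ k`. -/
theorem Model.energy_le_frozenCore {F : Model k} {F' : Model k'} (hC : ∀ x, φ x ∉ C)
    (hh : ∀ x y, F.h x y = F'.h (φ x) (φ y) + ∑ c ∈ C, (F'.eri (φ x) (φ y) c c + F'.eri c c (φ x) (φ y)) -
      (1 / 2 : ℚ) * ∑ c ∈ C, (F'.eri (φ x) c c (φ y) + F'.eri c (φ y) (φ x) c))
    (hg : ∀ x y z w, F.eri x y z w = F'.eri (φ x) (φ y) (φ z) (φ w))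
    (hc : F.ecore = F'.ecore + (2 * ∑ c ∈ C, F'.h c c + ∑ c ∈ C, ∑ d ∈ C, (2 * F'.eri c c d d - F'.eri c d d c)))
    {a b : ℕ} (ha : a ≤ k) (hb : b ≤ k) : F'.energy (a + C.card) (b + C.card) ≤ F.energy a b := by
  have hK := disjoint_orbs_rangeF_orbEmb φ hC
  rw [Model.energy, Model.energy, sectorGroundEnergy_def, sectorGroundEnergy_def,
    ← Model.hamiltonian_frozenCore φ hC hh hg hc]
  exact minEnergyOn_le_minEnergyOn_compression F'.hamiltonian _ (conjTranspose_frozenEmbed_mul_self _ hK)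
    _ _ (szSector_upDown_ne_bot (by rwa [Fintype.card_fin]) (by rwa [Fintype.card_fin]))
    (fun ψ hψ => (mem_szSector_iff_isInSector _ _ _).2
      (isInSector_frozenEmbed_orbs_mulVec φ hC ((mem_szSector_iff_isInSector a b ψ).1 hψ)))

/-- **THE SINGLET ENERGIES LIKEWISE**: `F'.singletEnergy (n + |C|) ≤ F.singletEnergy n` for `n ≤ k`
(a closed-shell core does not change the total spin). -/
theorem Model.singletEnergy_le_frozenCore {F : Model k} {F' : Model k'} (hC : ∀ x, φ x ∉ C)
    (hh : ∀ x y, F.h x y = F'.h (φ x) (φ y) + ∑ c ∈ C, (F'.eri (φ x) (φ y) c c + F'.eri c c (φ x) (φ y)) -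
      (1 / 2 : ℚ) * ∑ c ∈ C, (F'.eri (φ x) c c (φ y) + F'.eri c (φ y) (φ x) c))
    (hg : ∀ x y z w, F.eri x y z w = F'.eri (φ x) (φ y) (φ z) (φ w))
    (hc : F.ecore = F'.ecore + (2 * ∑ c ∈ C, F'.h c c + ∑ c ∈ C, ∑ d ∈ C, (2 * F'.eri c c d d - F'.eri c d d c)))
    {n : ℕ} (hn : n ≤ k) : F'.singletEnergy (n + C.card) ≤ F.singletEnergy n := by
  have hK := disjoint_orbs_rangeF_orbEmb φ hC
  rw [Model.singletEnergy, Model.singletEnergy, ← Model.hamiltonian_frozenCore φ hC hh hg hc]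
  exact minEnergyOn_le_minEnergyOn_compression F'.hamiltonian _ (conjTranspose_frozenEmbed_mul_self _ hK)
    _ _ (szSector_inf_ker_spinPlus_ne_bot (by rwa [Fintype.card_fin]))
    (fun ψ hψ => frozenEmbed_orbs_mulVec_mem_singletSector φ hC hψ)

/-- **UPPER ROWS TRANSPORT from the active-space model to the full model** (shifted sector): a certified
upper bound for the frozen-core model is a certified upper bound for the model with the core unfrozen. The
converse for LOWER rows is false in general and is NOT a theorem of this file. -/
theorem UpperRow.frozenCore {F : Model k} {F' : Model k'} (hC : ∀ x, φ x ∉ C)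
    (hh : ∀ x y, F.h x y = F'.h (φ x) (φ y) + ∑ c ∈ C, (F'.eri (φ x) (φ y) c c + F'.eri c c (φ x) (φ y)) -
      (1 / 2 : ℚ) * ∑ c ∈ C, (F'.eri (φ x) c c (φ y) + F'.eri c (φ y) (φ x) c))
    (hg : ∀ x y z w, F.eri x y z w = F'.eri (φ x) (φ y) (φ z) (φ w))
    (hc : F.ecore = F'.ecore + (2 * ∑ c ∈ C, F'.h c c + ∑ c ∈ C, ∑ d ∈ C, (2 * F'.eri c c d d - F'.eri c d d c)))
    {a b : ℕ} {hi : ℚ} (h : UpperRow F a b hi) : UpperRow F' (a + C.card) (b + C.card) hi := by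
  have hk := card_active_add_core_le φ hC
  exact ⟨by have := h.1; omega, by have := h.2.1; omega,
    (Model.energy_le_frozenCore φ hC hh hg hc h.1 h.2.1).trans h.2.2⟩

/-- **SINGLET UPPER ROWS TRANSPORT** likewise: `SingletUpperRow F n hi → SingletUpperRow F' (n + |C|) hi`. -/
theorem SingletUpperRow.frozenCore {F : Model k} {F' : Model k'} (hC : ∀ x, φ x ∉ C)
    (hh : ∀ x y, F.h x y = F'.h (φ x) (φ y) + ∑ c ∈ C, (F'.eri (φ x) (φ y) c c + F'.eri c c (φ x) (φ y)) -
      (1 / 2 : ℚ) * ∑ c ∈ C, (F'.eri (φ x) c c (φ y) + F'.eri c (φ y) (φ x) c))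
    (hg : ∀ x y z w, F.eri x y z w = F'.eri (φ x) (φ y) (φ z) (φ w))
    (hc : F.ecore = F'.ecore + (2 * ∑ c ∈ C, F'.h c c + ∑ c ∈ C, ∑ d ∈ C, (2 * F'.eri c c d d - F'.eri c d d c)))
    {n : ℕ} {hi : ℚ} (h : SingletUpperRow F n hi) : SingletUpperRow F' (n + C.card) hi := by
  have hk := card_active_add_core_le φ hC
  exact ⟨by have := h.1; omega, (Model.singletEnergy_le_frozenCore φ hC hh hg hc h.1).trans h.2⟩

/-- **Basis truncation is variational** (the case of NO core, `C = ∅`): if `F` is the restriction of `F'`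
to a subset of its orbitals (`F.h = F'.h ∘ φ`, `F.eri = F'.eri ∘ φ`, same `ecore`), then every sector
energy of `F'` is at most that of `F`: `F'.energy a b ≤ F.energy a b` (`a, b ≤ k`). Adding orbitals to a
model can only lower its exact energies; a certified LOWER bound for the small model is not one for the
large model. -/
theorem Model.energy_le_restrict {F : Model k} {F' : Model k'} (hh : ∀ x y, F.h x y = F'.h (φ x) (φ y))
    (hg : ∀ x y z w, F.eri x y z w = F'.eri (φ x) (φ y) (φ z) (φ w)) (hc : F.ecore = F'.ecore)
    {a b : ℕ} (ha : a ≤ k) (hb : b ≤ k) : F'.energy a b ≤ F.energy a b := by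
  have h := Model.energy_le_frozenCore φ (C := ∅) (F := F) (F' := F') (fun x => Finset.notMem_empty _)
    (fun x y => by rw [hh]; simp) hg (by rw [hc]; simp) ha hb
  simpa using h

/-- Upper rows of a restricted model are upper rows of the larger model (same sector). -/
theorem UpperRow.restrict {F : Model k} {F' : Model k'} (hh : ∀ x y, F.h x y = F'.h (φ x) (φ y))
    (hg : ∀ x y z w, F.eri x y z w = F'.eri (φ x) (φ y) (φ z) (φ w)) (hc : F.ecore = F'.ecore)
    {a b : ℕ} {hi : ℚ} (h : UpperRow F a b hi) : UpperRow F' a b hi := by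
  have hk : k ≤ k' := by simpa using card_active_add_core_le φ (C := ∅) (fun x => Finset.notMem_empty _)
  exact ⟨h.1.trans hk, h.2.1.trans hk, (Model.energy_le_restrict φ hh hg hc h.1 h.2.1).trans h.2.2⟩

end Model

end Summit.Ventures.CertifiedQuantumChemistry

end
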